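import Literature.AlgebraicGeometry.Frobenioids.PerfectionUntrCommuteEquiv
import HarnessLib

/-!
# [FrdI] Prop. 5.5 (ii), first clause: compatibility of `(C^pf)^un-tr ≅ (C^un-tr)^pf` with the functors to the
# elementary Frobenioid `F_{Φ^pf}` (PROOFS; the printed strong form)

[cite: MochizukiFrdI2008, Prop. 5.5 (ii) p.104]

Mochizuki, *The geometry of Frobenioids I*, Prop. 5.5 (ii) (p. 104): the equivalence `(C^pf)^un-tr ≅ (C^un-tr)^pf`
is "compatible with the functors to the respective elementary Frobenioids".  The sub-statement
`FrdI.Prop55Sub.Prop55ii_untr` of `Prop55Sub.lean` records this over the base `D` only (its FLAG (c): "weaker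
than print's compatibility with the functors to `F_{Φ^pf}`"); the slot is closed (`FrdI.Prop55Sub.Prop55ii_untr_holds`,
`PerfectionUntrCommuteEquiv.lean`).  This proof-only sequel removes the weakening for THE comparison functor
`PerfectionUntr.comparison` of `PerfectionUntrCommute.lean`: both structure functors take values in the SAME
elementary Frobenioid `F_{Φ^pf}` (the divisor monoids of `(C^un-tr)^pf` and of `C^pf` are both `Φ(-)^pf`), and
* `Perfection.div_repMap` — the perfected divisor of `G^pf[r]` computed through `G` (complement to
  `PerfectionFunctorialityComplements.lean`);
* `toFunctor_map_inclMap_map`, `toFunctor_map_untrMap_map` — `I = ι^pf` and `U = j^pf` lie over `F_{Φ^pf}` ON THE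
  NOSE (`Base`, `Div`, `deg_Fr`);
* `nonempty_comparison_comp_toFunctor_iso` — `comparison ⋙ (C^un-tr)^pf → F_{Φ^pf} ≅ (C^pf)^un-tr → F_{Φ^pf}`
  (the latter = the structure functor `untrFunctor hPf` of `(C^pf)^un-tr`, which needs `C^pf` to be a Frobenioid,
  Prop. 3.2 (iii), hypothesis `hPf`), with components the images of the chosen isomorphisms `c_X : I P_X ≅ X`.
DISCLOSURE: nothing printed is weakened or strengthened; "Frobenius-isotropic type" is used as in the parent files;
nothing here bears on [IUTchIII] Cor. 3.12.
-/

namespace Literature.AlgebraicGeometry.Frobenioids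

namespace PreFrobenioid

open CategoryTheory Opposite

/-! ### The perfected divisor of `G^pf[r]` -/

namespace Perfection

section MapDiv

universe w v v₁' u u₁' v₂' u₂'

variable {D : Type u} [Category.{v} D] {Φ : Dᵒᵖ ⥤ CommMonCat.{w}}
  {C₁ : Type u₁'} [Category.{v₁'} C₁] {F₁ : C₁ ⥤ ElemFrobenioid Φ} {hF₁ : IsFrobenioid F₁}
  {C₂ : Type u₂'} [Category.{v₂'} C₂] {F₂ : C₂ ⥤ ElemFrobenioid Φ} {hF₂ : IsFrobenioid F₂}
  {G : C₁ ⥤ C₂} (hG : IsFrobeniusCompatible F₁ F₂ G)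
include hG

/-- The perfected divisor of `G^pf[r]`, computed through `G`: `((G frob_A)^* Div(G r))^{1/(n·a)}` (the comparison
isomorphisms are isometries lying under `G A`). [cite: MochizukiFrdI2008, Prop. 3.2 (i) p.58] -/
theorem div_repMap {X Y : Perfection hF₁} (r : Rep X Y) :
    (repMap (hF₁ := hF₁) (hF₂ := hF₂) hG r).div =
      Frobenioids.Perfection.mk (pull Φ (Base F₂ (G.map (frob hF₁ X.obj r.L.a))) (Div F₂ (G.map r.hom)))
        (X.idx * r.L.a) := by
  have hA := map_frob_frobPowIso (hF₁ := hF₁) (hF₂ := hF₂) hG X.obj r.L.a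
  unfold Rep.div repMap
  dsimp only [objMap, levelMap]
  rw [div_comp, div_comp_iso hF₂.isPreFrobenioid,
    show Div F₂ (frobPowIso (hF₁ := hF₁) (hF₂ := hF₂) hG X.obj r.L.a).inv = 1 from
      isIsometry_of_isIso F₂ hF₂.isPreFrobenioid _,
    one_pow, mul_one, ← pull_comp, ← base_comp, ← hA, Category.assoc, Iso.hom_inv_id, Category.comp_id]

end MapDiv

end Perfection

/-! ### `I` and `U` lie over `F_{Φ^pf}` on the nose -/

universe w v v' u u'

variable {D : Type u} [Category.{v} D] {Φ : Dᵒᵖ ⥤ CommMonCat.{w}}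
  {C : Type u'} [Category.{v'} C] {F : C ⥤ ElemFrobenioid Φ} {hF : IsFrobenioid F}

open PreFrobenioidData (ofFunctor)

namespace PerfectionUntr

/-- `Div(I f) = Div(f)` in `Φ(Base A)^pf`. [cite: MochizukiFrdI2008, Prop. 5.5 (ii) p.104] -/
theorem div_inclMap_map {P Q : Perfection (isFrobenioid_istr hF)} (f : P ⟶ Q) :
    (Perfection.ops hF).div ((inclMap hF).map f) = (Perfection.ops (isFrobenioid_istr hF)).div f := by
  obtain ⟨r, rfl⟩ := Perfection.Hom.mk_surjective f
  exact Perfection.div_repMap (hF₁ := isFrobenioid_istr hF) (hF₂ := hF) (isFrobeniusCompatible_istrι hF) r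

/-- `Div(U f) = Div(f)` in `Φ(Base A)^pf`. [cite: MochizukiFrdI2008, Prop. 5.5 (ii) p.104] -/
theorem div_untrMap_map {P Q : Perfection (isFrobenioid_istr hF)} (f : P ⟶ Q) :
    (Perfection.ops (isFrobenioid_untr hF)).div ((untrMap hF).map f) =
      (Perfection.ops (isFrobenioid_istr hF)).div f := by
  obtain ⟨r, rfl⟩ := Perfection.Hom.mk_surjective f
  exact Perfection.div_repMap (hF₁ := isFrobenioid_istr hF) (hF₂ := isFrobenioid_untr hF)
    (isFrobeniusCompatible_istrToUntr hF) r

/-- **`I` lies over `F_{Φ^pf}` on the nose**: the structure functors of `(C^istr)^pf` and `C^pf` agree along `I`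
(`Base`, `Div`, `deg_Fr`). [cite: MochizukiFrdI2008, Prop. 5.5 (ii) p.104] -/
theorem toFunctor_map_inclMap_map {P Q : Perfection (isFrobenioid_istr hF)} (f : P ⟶ Q) :
    (Perfection.ops hF).toFunctor.map ((inclMap hF).map f) =
      (Perfection.ops (isFrobenioid_istr hF)).toFunctor.map f :=
  ElemFrobenioid.Hom.ext (base_map_inclMap_map f) (div_inclMap_map f) (degFr_inclMap_map f)

/-- **`U` lies over `F_{Φ^pf}` on the nose**: the structure functors of `(C^istr)^pf` and `(C^un-tr)^pf` agree
along `U`. [cite: MochizukiFrdI2008, Prop. 5.5 (ii) p.104] -/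
theorem toFunctor_map_untrMap_map {P Q : Perfection (isFrobenioid_istr hF)} (f : P ⟶ Q) :
    (Perfection.ops (isFrobenioid_untr hF)).toFunctor.map ((untrMap hF).map f) =
      (Perfection.ops (isFrobenioid_istr hF)).toFunctor.map f :=
  ElemFrobenioid.Hom.ext (base_map_untrMap_map f) (div_untrMap_map f) (degFr_untrMap_map f)

/-! ### The comparison functor lies over `F_{Φ^pf}` -/

/-- **Prop. 5.5 (ii), first clause, the printed compatibility**: `comparison ⋙ ((C^un-tr)^pf → F_{Φ^pf})` is
naturally isomorphic to the structure functor `(C^pf)^un-tr → F_{Φ^pf}` (= `untrFunctor hPf`, available once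
`C^pf` is a Frobenioid, Prop. 3.2 (iii), hypothesis `hPf`); components are the images in `F_{Φ^pf}` of the chosen
isomorphisms `c_X : I P_X ≅ X`. [cite: MochizukiFrdI2008, Prop. 5.5 (ii) p.104] -/
theorem nonempty_comparison_comp_toFunctor_iso (hiso : IsOfType (IsFrobeniusIsotropic F))
    (hPf : IsFrobenioid (Perfection.ops hF).toFunctor) :
    Nonempty (comparison hF hiso ⋙ (Perfection.ops (isFrobenioid_untr hF)).toFunctor ≅ untrFunctor hPf) := by
  refine ⟨CategoryTheory.Quotient.natIsoLift _ (NatIso.ofComponents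
    (fun X => (Perfection.ops hF).toFunctor.mapIso (preIso hF hiso X.obj)) (fun {X Y} u => ?_))⟩
  have h₁ := toFunctor_map_untrMap_map (hF := hF) (preHom hF hiso u.hom)
  have h₂ := toFunctor_map_inclMap_map (hF := hF) (preHom hF hiso u.hom)
  rw [inclMap_map_preHom] at h₂
  have key := (Perfection.ops hF).toFunctor.congr_map
    (show ((preIso hF hiso X.obj).hom ≫ u.hom ≫ (preIso hF hiso Y.obj).inv) ≫ (preIso hF hiso Y.obj).hom =
        (preIso hF hiso X.obj).hom ≫ u.hom by
      simp only [Category.assoc, Iso.inv_hom_id, Category.comp_id])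
  rw [Functor.map_comp, (Perfection.ops hF).toFunctor.map_comp (preIso hF hiso X.obj).hom u.hom,
    ← h₁.trans h₂.symm] at key
  exact key

end PerfectionUntr

/-- **[FrdI] Prop. 5.5 (ii), first clause, with the printed compatibility**: for `C` of Frobenius-isotropic type
there is an equivalence `(C^pf)^un-tr ≌ (C^un-tr)^pf` whose functor, composed with `(C^un-tr)^pf → F_{Φ^pf}`, is
isomorphic to `(C^pf)^un-tr → F_{Φ^pf}` (GIVEN that `C^pf` is a Frobenioid, `hPf`, so that the latter is the
structure functor `untrFunctor hPf`). Strengthens the Base-level clause of `FrdI.Prop55Sub.Prop55ii_untr`.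
[cite: MochizukiFrdI2008, Prop. 5.5 (ii) p.104] -/
theorem prop55ii_untr_elem (hF : IsFrobenioid F) (hiso : IsOfType (IsFrobeniusIsotropic F)) :
    ∃ e : (Perfection.ops hF).Untr ≌ PreFrobenioid.Perfection (isFrobenioid_untr hF),
      ∀ hPf : IsFrobenioid (Perfection.ops hF).toFunctor,
        Nonempty (e.functor ⋙ (Perfection.ops (isFrobenioid_untr hF)).toFunctor ≅ untrFunctor hPf) :=
  haveI := PerfectionUntr.comparison_isEquivalence (hF := hF) hiso
  ⟨(PerfectionUntr.comparison hF hiso).asEquivalence,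
    fun hPf => PerfectionUntr.nonempty_comparison_comp_toFunctor_iso hiso hPf⟩

end PreFrobenioid

end Literature.AlgebraicGeometry.Frobenioids
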